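import Literature.Computability.AlgebraicComplexity.DepthThreeChasmCircuits
import Literature.Computability.AlgebraicComplexity.RazTildeBlocks
import Literature.Computability.Complexity.KWProtocol
import Literature.Computability.Complexity.KWProtocolBounds
import Literature.Computability.Complexity.KWProtocolFormula
import Summits.ValiantsHypothesis.ValiantsHypothesis.Theorems.ShallowShadowsShadowFormulaTransferShadowOfSos
import Summits.ValiantsHypothesis.ValiantsHypothesis.Theorems.ShallowShadowsShadowFormulaTransferKWOrAnd
import HarnessLib

/-!
# Crux `ShallowShadows.ShadowFormulaTransfer` (stmt-ValiantsHypothesis-17124), line `Sketch` —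
# the registered stub `stub_oneProductShadow` (first bite `T = 1`: ONE product of affine forms)

The SHADOW of a polynomial `g ∈ ℂ[x_i : i ∈ ι]` is the monotone Boolean function
`B g : a ↦ [∃ m ∈ supp g, supp m ⊆ {i | a i}]`. For ONE scaled product of affine forms
`g = c · Π_{π<D} ℓ_π`, `ℓ_π = Σ_j v_{πj} x_j + b_π`, over the DOMAIN `ℂ[x]` the shadow is read off
factor by factor. With the face restriction `ρ_a = bind₁ (l ↦ if a l then X l else 0)` one has
`B q a ↔ ρ_a q ≠ 0` (`shadow_iff_restrictFace_ne_zero`), and `ρ_a g = c · Π_π ρ_a ℓ_π` is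
nonzero iff `c ≠ 0` and every `ρ_a ℓ_π = Σ_{j : a j} v_{πj} x_j + b_π` is nonzero, i.e. iff
`c ≠ 0` and for every `π` either `b_π ≠ 0` or some `j` has `a j = 1` and `v_{πj} ≠ 0`
(`shadow_smul_prod_affVal_iff`). So `B g` is identically false (`c = 0`, or a factor is the zero
form), or it is the monotone CNF `∧_{π : b_π = 0} ∨_{j : v_{πj} ≠ 0} x_j` with at most `D`
clauses over `N = #ι` variables (possibly constant; a constant function has no formula over
`{∧₂, ∨₂}` and its `formulaSizeOver monotoneBasis` is the junk value `0`,
`formulaSizeOver_monotoneBasis_eq_zero_of_not_nonconst`).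

The monotone Karchmer–Wigderson game of such a CNF has the folklore protocol of depth
`≤ ⌈log₂ D⌉ + ⌈log₂ N⌉` (Karchmer–Wigderson 1990, §2; Jukna, *Boolean Function Complexity*,
§3.3): Bob, holding a false point `b`, names a violated clause `π` (`⌈log₂ D⌉` bits); Alice,
holding a true point `a`, names a variable `j` of that clause with `a j = 1` (`⌈log₂ N⌉` bits);
then `b j = 0`. Here it is assembled from the tree's combinators (`exists_kwTree_cnf`): one
clause `∨_{j ∈ S} x_j` is the DNF of the singletons `{j}`, `j ∈ S`
(`KWTree.exists_solvesMono_of_terms`, depth `≤ ⌈log₂ N⌉`), and the conjunction of the `D` clause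
protocols is `exists_kwTree_or_and` with `T = 1`. By the easy direction of Karchmer–Wigderson
(`KWTree.formulaSizeOver_le_two_pow_depth`) the monotone formula size of the shadow is at most
`2^{⌈log₂ D⌉} · 2^{⌈log₂ N⌉} ≤ (2D+1)(2N+1) ≤ 4(D+1)(N+1)` (`RazBlocks.two_pow_clog_le`).

Main results: `formulaSizeOver_shadow_smul_prod_affVal_le` (any `decide`-spelling `B` of the
shadow) and the registered signature `stub_oneProductShadow`.

## References

* [KarchmerWigderson1990] M. Karchmer, A. Wigderson, *Monotone circuits for connectivity require
  super-logarithmic depth*, SIAM J. Discrete Math. 3 (1990) 255–265, §2 (the monotone game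
  `R_f^m`; protocols for `f ∨ g`, `f ∧ g`; the DNF protocol).
* [JuknaBFC2012] S. Jukna, *Boolean Function Complexity* (2012), §3.3.
-/

-- Sub = Summit single-conjunct layout: the duplicated namespace component is mandated by the tree.
set_option linter.dupNamespace false

noncomputable section

namespace Summit.ValiantsHypothesis.ValiantsHypothesis.Theorems.ShallowShadowsShadowFormulaTransfer

open Literature.Computability.AlgebraicComplexity Literature.Computability.Complexity
open Literature.Computability.AlgebraicComplexity.DepthThreeChasm
open MvPolynomial

/-! ### The shadow of one product of affine forms -/

/-- An affine form `Σ_j v_j x_j + b` is a nonzero polynomial iff `b ≠ 0` or some `v_j ≠ 0`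
(compare the constant coefficient and the coefficient of `x_j`). [folklore] -/
theorem affVal_ne_zero_iff {ι k : Type*} [CommSemiring k] [Fintype ι] (v : ι → k) (b : k) :
    affVal (v, b) ≠ 0 ↔ b ≠ 0 ∨ ∃ j, v j ≠ 0 := by
  classical
  constructor
  · intro h
    by_contra hcon
    push Not at hcon
    refine h ?_
    rw [affVal_apply, hcon.1, C_0, add_zero]
    exact Finset.sum_eq_zero fun j _ => by rw [hcon.2 j, zero_smul]
  · rintro (hb | ⟨j, hj⟩) h0
    · refine hb ?_
      have h := congr_arg (coeff 0) h0
      simpa only [affVal_apply, coeff_add, coeff_sum, coeff_smul, coeff_zero_X, smul_zero,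
        Finset.sum_const_zero, zero_add, coeff_zero_C, coeff_zero] using h
    · refine hj ?_
      have h := congr_arg (coeff (Finsupp.single j 1)) h0
      rw [affVal_apply, coeff_add, coeff_sum,
        coeff_C_of_ne_zero (Finsupp.single_ne_zero.mpr one_ne_zero), add_zero, coeff_zero,
        Finset.sum_eq_single j (fun j' _ hj' => by
          rw [coeff_smul, coeff_X, if_neg ((Finsupp.single_left_inj one_ne_zero).not.mpr hj'),
            smul_zero]) (fun hj => absurd (Finset.mem_univ j) hj),
        coeff_smul, coeff_X_same, smul_eq_mul, mul_one] at h
      exact h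

/-- The face restriction `ρ_a = bind₁ (l ↦ if a l then X l else 0)` of an affine form is the
affine form with the coefficients outside the face `{j | a j}` deleted. [folklore] -/
theorem restrictFace_affVal {ι k : Type*} [CommSemiring k] [Fintype ι] (a : ι → Bool)
    (φ : (ι → k) × k) :
    bind₁ (fun l => if a l then (X l : MvPolynomial ι k) else 0) (affVal φ) =
      affVal (fun j => if a j then φ.1 j else 0, φ.2) := by
  simp only [affVal, map_add, map_sum, map_smul, bind₁_X_right, bind₁_C_right]
  congr 1
  refine Finset.sum_congr rfl fun j _ => ?_
  by_cases hj : a j = true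
  · rw [if_pos hj, if_pos hj]
  · rw [if_neg hj, if_neg hj, smul_zero, zero_smul]

/-- The face restriction of an affine form `Σ_j v_j x_j + b` to the face `a` is nonzero iff
`b ≠ 0` or some `j` with `a j = 1` has `v_j ≠ 0`. [folklore] -/
theorem restrictFace_affVal_ne_zero_iff {ι k : Type*} [CommSemiring k] [Fintype ι]
    (a : ι → Bool) (φ : (ι → k) × k) :
    bind₁ (fun l => if a l then (X l : MvPolynomial ι k) else 0) (affVal φ) ≠ 0 ↔
      φ.2 ≠ 0 ∨ ∃ j, a j = true ∧ φ.1 j ≠ 0 := by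
  rw [restrictFace_affVal, affVal_ne_zero_iff]
  refine or_congr_right (exists_congr fun j => ?_)
  by_cases hj : a j = true
  · simp [hj]
  · simp [hj]

/-- **The shadow of one product of affine forms.** Over the domain `ℂ[x]`, the shadow of
`c · Π_π ℓ_π` holds at `a` iff `c ≠ 0` and every factor survives the restriction to the face
`a`: its constant term is nonzero, or one of its variables `j` with nonzero coefficient has
`a j = 1`. [folklore] -/
theorem shadow_smul_prod_affVal_iff {ι : Type*} [Fintype ι] {D : ℕ} (c : ℂ)
    (ℓ : Fin D → (ι → ℂ) × ℂ) (a : ι → Bool) :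
    (∃ m ∈ (c • ∏ π, affVal (ℓ π)).support, ∀ i ∈ m.support, a i = true) ↔
      c ≠ 0 ∧ ∀ π, (ℓ π).2 ≠ 0 ∨ ∃ j, a j = true ∧ (ℓ π).1 j ≠ 0 := by
  rw [shadow_iff_restrictFace_ne_zero, smul_eq_C_mul, map_mul, bind₁_C_right, map_prod,
    mul_ne_zero_iff, Finset.prod_ne_zero_iff]
  refine and_congr (not_congr C_eq_zero) ⟨fun h π => ?_, fun h π _ => ?_⟩
  · exact (restrictFace_affVal_ne_zero_iff a (ℓ π)).mp (h π (Finset.mem_univ π))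
  · exact (restrictFace_affVal_ne_zero_iff a (ℓ π)).mpr (h π)

/-! ### The CNF protocol -/

/-- **The CNF protocol** for the monotone Karchmer–Wigderson game (folklore; Karchmer–Wigderson
1990, §2): if `h` is (any spelling of) the conjunction over `π < D` of the clauses "`triv π`, or
some `x_j` with `S π j`" — the constant-true clause when `triv π`, the monotone clause
`∨_{j : S π j} x_j` otherwise — on a nonempty finite variable set of size `N`, then its monotone
game has a protocol tree of depth `≤ ⌈log₂ D⌉ + ⌈log₂ N⌉`: Bob names a clause violated by `b`,
Alice a variable of it that is `1` in `a`. Assembled from `KWTree.exists_solvesMono_of_terms`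
(one clause = the DNF of its singletons, depth `≤ ⌈log₂ N⌉`; a constant-true clause is solved
vacuously by any tree) and `exists_kwTree_or_and` with `T = 1`.
[cite: KarchmerWigderson1990, §2] -/
theorem exists_kwTree_cnf {ι : Type*} [Fintype ι] [Nonempty ι] {D : ℕ} (triv : Fin D → Prop)
    (S : Fin D → ι → Prop) (h : (ι → Bool) → Bool)
    (hh : ∀ a, h a = true ↔ ∀ π, triv π ∨ ∃ j, a j = true ∧ S π j) :
    ∃ Q : KWTree ι, Q.SolvesMono h ∧ Q.depth ≤ Nat.clog 2 D + Nat.clog 2 (Fintype.card ι) := by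
  classical
  -- one clause `∨_{j : S π j} x_j` is the DNF of the singletons `{j}`, `S π j`: depth `≤ ⌈log₂ N⌉`
  have hclause : ∀ π : Fin D, ∃ P : KWTree ι,
      P.SolvesMono (fun a => decide (∃ j, a j = true ∧ S π j)) ∧
        P.depth ≤ Nat.clog 2 (Fintype.card ι) + 0 := by
    intro π
    refine KWTree.exists_solvesMono_of_terms
      ((Finset.univ.filter fun j => S π j).image fun j => ({j} : Finset ι)) _ (fun a => ?_) _ _
      ?_ ?_
    · rw [decide_eq_true_iff, Finset.exists_mem_image]
      simp only [Finset.mem_filter, Finset.mem_univ, true_and, Finset.mem_singleton, forall_eq]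
      exact exists_congr fun j => and_comm
    · exact Finset.card_image_le.trans
        ((Finset.card_le_univ _).trans (Nat.le_pow_clog one_lt_two _))
    · intro T hT
      obtain ⟨j, -, rfl⟩ := Finset.mem_image.mp hT
      simp
  choose P hP hD using hclause
  -- the clause protocol also solves the game of the clause "`triv π` or `∨_{j : S π j} x_j`"
  have hP' : ∀ (_i : Fin 1) (π : Fin D),
      (P π).SolvesMono (fun a => decide (triv π ∨ ∃ j, a j = true ∧ S π j)) := by
    intro _ π a b ha hb
    obtain ⟨hbt, hbS⟩ := not_or.mp (of_decide_eq_false hb)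
    exact hP π a b (decide_eq_true ((of_decide_eq_true ha).resolve_left hbt))
      (decide_eq_false hbS)
  have hD' : ∀ (_i : Fin 1) (π : Fin D), (P π).depth ≤ Nat.clog 2 (Fintype.card ι) :=
    fun _ π => (hD π).trans (Nat.add_zero _).le
  have hg : ∀ a, h a = true ↔
      ∃ _i : Fin 1, ∀ π, decide (triv π ∨ ∃ j, a j = true ∧ S π j) = true := fun a =>
    (hh a).trans
      ⟨fun H => ⟨0, fun π => decide_eq_true (H π)⟩, fun ⟨_, H⟩ π => of_decide_eq_true (H π)⟩
  obtain ⟨Q, hQ, hQd⟩ := exists_kwTree_or_and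
    (fun (_ : Fin 1) π a => decide (triv π ∨ ∃ j, a j = true ∧ S π j)) (fun _ π => P π)
    hP' hD' h hg
  refine ⟨Q, hQ, ?_⟩
  simpa only [Nat.clog_one_right, zero_add] using hQd

/-! ### One product of affine forms casts a shallow shadow -/

/-- **One product of affine forms casts a shallow shadow** (abstract form, for any
`decide`-spelling `B` of the shadow): for `g = c · Π_{π<D} ℓ_π` over `ℂ` in `N = #ι` variables,
`formulaSizeOver monotoneBasis B ≤ 4 (D+1) (N+1)`. If `B` does not take both values (in
particular if `ι` is empty, `c = 0`, or a factor is the zero form) the left side is the junk value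
`0`; otherwise `ι` is nonempty, `c ≠ 0`, `B` is the CNF of `exists_kwTree_cnf` with
`triv π := (b_π ≠ 0)`, `S π j := (v_{πj} ≠ 0)` (`shadow_smul_prod_affVal_iff`), and
`formulaSizeOver ≤ 2^{⌈log₂ D⌉ + ⌈log₂ N⌉} ≤ (2D+1)(2N+1) ≤ 4(D+1)(N+1)`.
[cite: KarchmerWigderson1990, §2] -/
theorem formulaSizeOver_shadow_smul_prod_affVal_le {ι : Type*} [Fintype ι] {D : ℕ} (c : ℂ)
    (ℓ : Fin D → (ι → ℂ) × ℂ) (B : (ι → Bool) → Bool)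
    (hB : ∀ a, B a = true ↔ ∃ m ∈ (c • ∏ π, affVal (ℓ π)).support, ∀ i ∈ m.support, a i = true) :
    formulaSizeOver monotoneBasis B ≤ 4 * (D + 1) * (Fintype.card ι + 1) := by
  by_cases hne : (∃ a, B a = true) ∧ ∃ b, B b = false
  · obtain ⟨⟨a₁, ha₁⟩, b₀, hb₀⟩ := hne
    -- the variable set is nonempty, since `B a₁ ≠ B b₀`
    haveI : Nonempty ι := by
      by_contra hι
      haveI : IsEmpty ι := not_nonempty_iff.mp hι
      rw [Subsingleton.elim a₁ b₀, hb₀] at ha₁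
      exact Bool.false_ne_true ha₁
    -- `c ≠ 0`, since the shadow is not identically false
    have hc : c ≠ 0 := ((shadow_smul_prod_affVal_iff c ℓ a₁).mp ((hB a₁).mp ha₁)).1
    -- the CNF protocol for `B`, then protocol ⟹ formula
    obtain ⟨Q, hQ, hQd⟩ := exists_kwTree_cnf (fun π => (ℓ π).2 ≠ 0) (fun π j => (ℓ π).1 j ≠ 0) B
      fun a => (hB a).trans ((shadow_smul_prod_affVal_iff c ℓ a).trans (and_iff_right hc))
    calc formulaSizeOver monotoneBasis B ≤ 2 ^ Q.depth := Q.formulaSizeOver_le_two_pow_depth hQ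
      _ ≤ 2 ^ (Nat.clog 2 D + Nat.clog 2 (Fintype.card ι)) := Nat.pow_le_pow_right two_pos hQd
      _ = 2 ^ Nat.clog 2 D * 2 ^ Nat.clog 2 (Fintype.card ι) := pow_add _ _ _
      _ ≤ (2 * D + 1) * (2 * Fintype.card ι + 1) :=
          Nat.mul_le_mul (RazBlocks.two_pow_clog_le _) (RazBlocks.two_pow_clog_le _)
      _ ≤ 2 * (D + 1) * (2 * (Fintype.card ι + 1)) := Nat.mul_le_mul (by omega) (by omega)
      _ = 4 * (D + 1) * (Fintype.card ι + 1) := by ring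
  · rw [formulaSizeOver_monotoneBasis_eq_zero_of_not_nonconst hne]
    exact Nat.zero_le _

/-- **Stub `OneProductShadow`** (registered stub `stub_oneProductShadow` of line `Sketch`, crux
stmt-ValiantsHypothesis-17124; first bite `T = 1`): the shadow of `c · Π_{π<D} ℓ_π` (`ℓ_π` affine
over `ℂ`, `N = #ι`) is, over the domain `ℂ[x]`, the CNF `∧_{π : ℓ_π(0) = 0} ∨_{j ∈ supp ℓ_π} x_j`
(or does not take both values, junk value `0`), so its monotone formula size is at most
`4 (D+1) (N+1)` (Bob names a dead factor, Alice a live variable of it). Proof: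
`formulaSizeOver_shadow_smul_prod_affVal_le`. [cite: KarchmerWigderson1990, §2] -/
theorem stub_oneProductShadow :
    ∀ (ι : Type) [Fintype ι] [DecidableEq ι] (D : ℕ) (c : ℂ) (ℓ : Fin D → (ι → ℂ) × ℂ),
      formulaSizeOver monotoneBasis (fun a : ι → Bool =>
          decide (∃ m ∈ (c • ∏ π, affVal (ℓ π)).support, ∀ i ∈ m.support, a i = true)) ≤
        4 * (D + 1) * (Fintype.card ι + 1) :=
  fun _ _ _ _ c ℓ => formulaSizeOver_shadow_smul_prod_affVal_le c ℓ _ fun _ => decide_eq_true_iff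

end Summit.ValiantsHypothesis.ValiantsHypothesis.Theorems.ShallowShadowsShadowFormulaTransfer

end
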